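import Summits.ResolutionOfSingularities.ResolutionOfSingularities.Theorems.EquisingularLiftEquisingularLiftBlowupModelTransport
import Literature.AlgebraicGeometry.Motives.ProjectiveSpaceLinearSpanMaps
import HarnessLib

/-!
# Crux `EquisingularLift` (stmt-ResolutionOfSingularities-15660), line `Sketch` (v10c): `PGL`-transport of the crux's binder shape —
# an invertible linear substitution moves `range ι = V₊(F)` to `range ι₁ = V₊(σ F)`; blow-up models of `H` from ANY linear image being a cone

[OURS · leafhand-res-equisingularlift-6 g2, 2026-08-31; cell `pub/decomp-res`] AI-produced, weaker than expert review; NOT a statement of any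
manuscript; nothing here proves resolution of singularities in positive characteristic.  DEF-FREE helper, `--supports stmt-…-15660`; standard
axioms; ZERO named hypotheses; every field `k`.

Piece (q1′) of the lh6 g0 / g2 census for the quadric slice of the open residual `stub_blowupModel_ge_five`: for mutually inverse substitutions
by linear forms `τ, τ' : xᵢ ↦ Σ aᵢⱼ xⱼ` (`A ∈ GL_{n+2}(k)`), Mathlib's `Proj.map` of the graded homomorphism `σ_τ = aeval τ`
(✓ `ProjectiveSpace.linSubstGraded`, ✓ `irrelevant_le_map_linSubstGraded_of_mem_span`) is an AUTOMORPHISM `α` of `ℙⁿ⁺¹_k` (`Proj.map_comp`,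
`Proj.map_id`), acting on points by `p ∈ 𝔮_{α x} ↔ σ_τ p ∈ 𝔮_x`; hence:

* `X_mem_span_range_of_linSubst` — the variables lie in `(τ₀, …, τ_{n+1})` (the `Proj.map` hypothesis) for an invertible substitution;
* `map_linSubstGraded_comp_eq_id` — `α_τ ≫ α_{τ'} = 𝟙`;
* ★ `exists_closedImmersion_range_eq_of_linSubst` — **if `ι : H ↪ ℙⁿ⁺¹_k` is a closed immersion with `range ι = V₊(F)`, then
  `ι₁ := ι ≫ α_τ` is a closed immersion with `range ι₁ = V₊(σ_{τ'} F)`** (`σ_{τ'} F = F ∘ A⁻¹`, the equation in the new coordinates);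
* ★ `blowupModel_of_range_eq_of_linSubst_linCone` — hence, blow-up models being intrinsic (✓ `blowupModel_of_range_eq_linCone`), **every
  `(H, ι)` of the crux whose equation becomes, after an invertible linear change of coordinates, a cone `G(x_{ι 0}, …, x_{ι (m+1)})` over a
  prime form `G` with regular idle-variable charts (vertex a linear `ℙʳ`), has a regular blow-up model — every field, every characteristic,
  every dimension.**

REMAINING for ALL integral quadrics (exact, the one piece left): (q2) the char-free normal form — for `k` algebraically closed and `F` a PRIME
quadratic form in `n + 2 ≥ 3` variables there are mutually inverse linear substitutions `τ, τ'`, complementary injections `ι, e` and a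
NONSINGULAR quadratic form `G` in `m + 2 ≥ 3` variables with `σ_{τ'} F = rename ι G` (split off the singular radical
`{v ∈ rad b_F | F(v) = 0}` — a subspace also in characteristic `2` since `k` is perfect; M–L, pure algebra, NOT in the tree).
Honest: no registered stub closed.

References: [Hartshorne1977, II Ex. 2.14, II Example 7.1.1]; [GortzWedhorn2020, (13.7)].
-/

set_option linter.dupNamespace false -- mandated namespace `Summit.<Summit>.<Problem>` of this single-conjunct summit

noncomputable section

open CategoryTheory CategoryTheory.Limits AlgebraicGeometry TopologicalSpace
open MvPolynomial HomogeneousLocalization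
open Literature.AlgebraicGeometry.Resolution
open Literature.AlgebraicGeometry.Motives Literature.AlgebraicGeometry.Motives.SmoothHypersurface
open Literature.AlgebraicGeometry.Motives.ProjectiveSpace
open AlgebraicGeometry.Scheme.IdealSheafData
open Summit.ResolutionOfSingularities.ResolutionOfSingularities.Cruxes.EquisingularLiftNat.Sections

universe u

namespace Summit.ResolutionOfSingularities.ResolutionOfSingularities.Cruxes.EquisingularLift.StrataSplit

section LinSubst

variable {k : Type} [Field k] {n : ℕ} (τ τ' : Fin (n + 1 + 1) → MvPolynomial (Fin (n + 1 + 1)) k)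
  (hτ : ∀ i, (τ i).IsHomogeneous 1) (hτ' : ∀ i, (τ' i).IsHomogeneous 1)
  (hinv : ∀ i, aeval τ (τ' i) = X i) (hinv' : ∀ i, aeval τ' (τ i) = X i)

include hτ' hinv in
/-- For an invertible linear substitution every variable lies in the ideal of the forms: `xᵢ = σ_τ(τ'ᵢ) ∈ (τ₀, …, τ_{n+1})` (a linear form
is a combination of the variables). [folklore] -/
theorem X_mem_span_range_of_linSubst (j : Fin (n + 1 + 1)) :
    (X j : MvPolynomial (Fin (n + 1 + 1)) k) ∈ Ideal.span (Set.range τ) := by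
  classical
  rw [← hinv j]
  have hmem : τ' j ∈ Ideal.span (Set.range (X : Fin (n + 1 + 1) → MvPolynomial (Fin (n + 1 + 1)) k)) := by
    rw [(τ' j).as_sum]
    refine Ideal.sum_mem _ fun d hd => ?_
    have hdeg : 1 = ∑ l ∈ d.support, d l := (hτ' j).degree_eq_sum_deg_support hd
    obtain ⟨l, hl⟩ : ∃ l, l ∈ d.support := by
      by_contra h
      push Not at h
      rw [Finset.eq_empty_of_forall_notMem h, Finset.sum_empty] at hdeg
      exact one_ne_zero hdeg
    have hdl : 1 ≤ d l := Nat.one_le_iff_ne_zero.mpr (Finsupp.mem_support_iff.mp hl)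
    have hdvd : (X l : MvPolynomial (Fin (n + 1 + 1)) k) ∣ monomial d (coeff d (τ' j)) := by
      refine ⟨monomial (d - Finsupp.single l 1) (coeff d (τ' j)), ?_⟩
      rw [X, monomial_mul, one_mul, add_tsub_cancel_of_le (Finsupp.single_le_iff.mpr (by simpa using hdl))]
    exact Ideal.mem_of_dvd _ hdvd (Ideal.subset_span ⟨l, rfl⟩)
  have h := Ideal.mem_map_of_mem (aeval τ : MvPolynomial (Fin (n + 1 + 1)) k →ₐ[k] MvPolynomial (Fin (n + 1 + 1)) k).toRingHom hmem
  rw [Ideal.map_span, ← Set.range_comp] at h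
  have hfun : ((aeval τ : MvPolynomial (Fin (n + 1 + 1)) k →ₐ[k] MvPolynomial (Fin (n + 1 + 1)) k).toRingHom : _ → _) ∘ X = τ := by
    funext i
    simp
  rw [hfun] at h
  exact h

include hinv in
/-- `σ_τ ∘ σ_{τ'} = id` as graded homomorphisms. [folklore] -/
theorem linSubstGraded_comp_eq_id :
    (linSubstGraded τ hτ).comp (linSubstGraded τ' hτ') = GradedRingHom.id (homogeneousSubmodule (Fin (n + 1 + 1)) k) := by
  refine GradedRingHom.ext fun p => ?_
  rw [GradedRingHom.comp_apply, GradedRingHom.id_apply, linSubstGraded_apply, linSubstGraded_apply, ← AlgHom.comp_apply]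
  conv_rhs => rw [← AlgHom.id_apply (R := k) p]
  congr 1
  refine MvPolynomial.algHom_ext fun i => ?_
  rw [AlgHom.comp_apply, aeval_X, hinv, AlgHom.id_apply]

/-- `Proj.map` only depends on the graded homomorphism (proof-irrelevant hypothesis). [folklore] -/
theorem projMap_congr {f g : homogeneousSubmodule (Fin (n + 1 + 1)) k →+*ᵍ homogeneousSubmodule (Fin (n + 1 + 1)) k} (h : f = g)
    (hf : letI := MvPolynomial.gradedAlgebra (σ := Fin (n + 1 + 1)) (R := k)
      HomogeneousIdeal.irrelevant (homogeneousSubmodule (Fin (n + 1 + 1)) k) ≤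
        (HomogeneousIdeal.irrelevant (homogeneousSubmodule (Fin (n + 1 + 1)) k)).map f)
    (hg : letI := MvPolynomial.gradedAlgebra (σ := Fin (n + 1 + 1)) (R := k)
      HomogeneousIdeal.irrelevant (homogeneousSubmodule (Fin (n + 1 + 1)) k) ≤
        (HomogeneousIdeal.irrelevant (homogeneousSubmodule (Fin (n + 1 + 1)) k)).map g) :
    letI := MvPolynomial.gradedAlgebra (σ := Fin (n + 1 + 1)) (R := k)
    Proj.map f hf = Proj.map g hg := by
  subst h
  rfl

include hτ' hinv hinv' in
/-- **`α_τ ≫ α_{τ'} = 𝟙`**: `Proj.map σ_τ ≫ Proj.map σ_{τ'} = Proj.map (σ_τ ∘ σ_{τ'}) = Proj.map id = 𝟙` (`Proj.map_comp`, `Proj.map_id`).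
[cite: Hartshorne1977, II Ex. 2.14] -/
theorem map_linSubstGraded_comp_eq_id :
    letI := MvPolynomial.gradedAlgebra (σ := Fin (n + 1 + 1)) (R := k)
    Proj.map (linSubstGraded τ hτ) (irrelevant_le_map_linSubstGraded_of_mem_span τ hτ (X_mem_span_range_of_linSubst τ τ' hτ' hinv)) ≫
      Proj.map (linSubstGraded τ' hτ')
        (irrelevant_le_map_linSubstGraded_of_mem_span τ' hτ' (X_mem_span_range_of_linSubst τ' τ hτ hinv')) =
      𝟙 _ := by
  letI := MvPolynomial.gradedAlgebra (σ := Fin (n + 1 + 1)) (R := k)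
  have hA := irrelevant_le_map_linSubstGraded_of_mem_span τ hτ (X_mem_span_range_of_linSubst τ τ' hτ' hinv)
  have hB := irrelevant_le_map_linSubstGraded_of_mem_span τ' hτ' (X_mem_span_range_of_linSubst τ' τ hτ hinv')
  have h1 : Proj.map ((linSubstGraded τ hτ).comp (linSubstGraded τ' hτ')) (HomogeneousIdeal.irrelevant_le_map_comp hB hA) =
      Proj.map (linSubstGraded τ hτ) hA ≫ Proj.map (linSubstGraded τ' hτ') hB :=
    Proj.map_comp (linSubstGraded τ' hτ') (linSubstGraded τ hτ) hB hA
  have h2 : Proj.map ((linSubstGraded τ hτ).comp (linSubstGraded τ' hτ')) (HomogeneousIdeal.irrelevant_le_map_comp hB hA) =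
      Proj.map (GradedRingHom.id (homogeneousSubmodule (Fin (n + 1 + 1)) k)) (by simp) :=
    projMap_congr (linSubstGraded_comp_eq_id τ τ' hτ hτ' hinv) _ _
  rw [← h1, h2]
  exact Proj.map_id

/-- **The action on points** of `α_τ = Proj.map σ_τ`: `p ∈ 𝔮_{α_τ q} ↔ σ_τ p ∈ 𝔮_q` (Mathlib `ProjectiveSpectrum.comapFun`, `Iff.rfl`; the
echelon case is ✓ `ProjectiveSpace.mem_asHomogeneousIdeal_linSubstMap_iff`). [folklore] -/
theorem mem_asHomogeneousIdeal_projMap_linSubstGraded_iff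
    (h : letI := MvPolynomial.gradedAlgebra (σ := Fin (n + 1 + 1)) (R := k)
      HomogeneousIdeal.irrelevant (homogeneousSubmodule (Fin (n + 1 + 1)) k) ≤
        (HomogeneousIdeal.irrelevant (homogeneousSubmodule (Fin (n + 1 + 1)) k)).map (linSubstGraded τ hτ))
    (q : (projectiveSpace (n + 1) k).left) (p : MvPolynomial (Fin (n + 1 + 1)) k) :
    letI := MvPolynomial.gradedAlgebra (σ := Fin (n + 1 + 1)) (R := k)
    p ∈ ProjectiveSpectrum.asHomogeneousIdeal (𝒜 := homogeneousSubmodule (Fin (n + 1 + 1)) k)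
        ((Proj.map (linSubstGraded τ hτ) h).base q) ↔
      aeval τ p ∈ ProjectiveSpectrum.asHomogeneousIdeal (𝒜 := homogeneousSubmodule (Fin (n + 1 + 1)) k) q :=
  Iff.rfl

include hτ hτ' hinv hinv' in
/-- ★ **An invertible linear change of coordinates moves the crux's binder shape**: if `ι : H ↪ ℙⁿ⁺¹_k` is a closed immersion with
`range ι = V₊(F)` then `ι₁ := ι ≫ α_τ` is a closed immersion with `range ι₁ = V₊(σ_{τ'} F)` — `α_τ` is an automorphism (inverse `α_{τ'}`) acting on
points by `p ∈ 𝔮_{α_τ x} ↔ σ_τ p ∈ 𝔮_x`, and `σ_τ (σ_{τ'} F) = F`. [cite: Hartshorne1977, II Example 7.1.1] -/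
theorem exists_closedImmersion_range_eq_of_linSubst {H : Scheme.{0}} (ι : H ⟶ (projectiveSpace (n + 1) k).left)
    [IsClosedImmersion ι] (F : MvPolynomial (Fin (n + 1 + 1)) k)
    (hrange : letI := MvPolynomial.gradedAlgebra (σ := Fin (n + 1 + 1)) (R := k)
      Set.range ι = {x : Proj (homogeneousSubmodule (Fin (n + 1 + 1)) k) | F ∈ x.asHomogeneousIdeal}) :
    letI := MvPolynomial.gradedAlgebra (σ := Fin (n + 1 + 1)) (R := k)
    ∃ ι₁ : H ⟶ (projectiveSpace (n + 1) k).left, IsClosedImmersion ι₁ ∧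
      Set.range ι₁ = {x : Proj (homogeneousSubmodule (Fin (n + 1 + 1)) k) | aeval τ' F ∈ x.asHomogeneousIdeal} := by
  letI := MvPolynomial.gradedAlgebra (σ := Fin (n + 1 + 1)) (R := k)
  have hA := irrelevant_le_map_linSubstGraded_of_mem_span τ hτ (X_mem_span_range_of_linSubst τ τ' hτ' hinv)
  have hB := irrelevant_le_map_linSubstGraded_of_mem_span τ' hτ' (X_mem_span_range_of_linSubst τ' τ hτ hinv')
  let α : (projectiveSpace (n + 1) k).left ⟶ (projectiveSpace (n + 1) k).left := Proj.map (linSubstGraded τ hτ) hA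
  let β : (projectiveSpace (n + 1) k).left ⟶ (projectiveSpace (n + 1) k).left := Proj.map (linSubstGraded τ' hτ') hB
  have hαβ : α ≫ β = 𝟙 _ :=
    map_linSubstGraded_comp_eq_id (τ := τ) (τ' := τ') (hτ := hτ) (hτ' := hτ') (hinv := hinv) (hinv' := hinv')
  have hβα : β ≫ α = 𝟙 _ :=
    map_linSubstGraded_comp_eq_id (τ := τ') (τ' := τ) (hτ := hτ') (hτ' := hτ) (hinv := hinv') (hinv' := hinv)
  haveI : IsIso α := ⟨⟨β, hαβ, hβα⟩⟩
  refine ⟨ι ≫ α, inferInstance, ?_⟩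
  have hF : aeval τ (aeval τ' F) = F := by
    have h := congrArg (fun g : homogeneousSubmodule (Fin (n + 1 + 1)) k →+*ᵍ homogeneousSubmodule (Fin (n + 1 + 1)) k => g F)
      (linSubstGraded_comp_eq_id τ τ' hτ hτ' hinv)
    simpa using h
  ext y
  constructor
  · rintro ⟨x, rfl⟩
    have hx : ι x ∈ Set.range ι := ⟨x, rfl⟩
    rw [hrange] at hx
    show aeval τ' F ∈ ((ι ≫ α) x).asHomogeneousIdeal
    rw [Scheme.Hom.comp_apply]
    refine (mem_asHomogeneousIdeal_projMap_linSubstGraded_iff τ hτ hA (ι x) (aeval τ' F)).mpr ?_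
    rw [hF]
    exact hx
  · intro hy
    -- `y = α (β y)` and `F ∈ 𝔮_{β y}`
    have hyab : α (β y) = y := by
      rw [← Scheme.Hom.comp_apply, hβα]
      rfl
    have hβy : F ∈ (β y).asHomogeneousIdeal :=
      (mem_asHomogeneousIdeal_projMap_linSubstGraded_iff τ' hτ' hB y F).mpr hy
    have hmem : β y ∈ Set.range ι := by rw [hrange]; exact hβy
    obtain ⟨x, hx⟩ := hmem
    exact ⟨x, by rw [Scheme.Hom.comp_apply, hx, hyab]⟩

end LinSubst

/-! ## Blow-up models of `H` from any linear image being a (linear-vertex) cone -/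

/-- ★ **Every `(H, ι)` of the crux which is a cone IN SOME LINEAR COORDINATES has a regular blow-up model — every field, every characteristic,
every dimension**: `ι : H ↪ ℙⁿ⁺¹_k` a closed immersion, `H` integral, `range ι = V₊(F)`; `τ, τ'` mutually inverse linear substitutions with
`σ_{τ'} F = G(x_{ι' 0}, …, x_{ι' (m+1)})` for a prime form `G` with regular idle-variable charts and complementary injections `ι', e`
(vertex `ℙʳ`); then `H` carries a non-zero ideal sheaf all of whose blow-ups are regular (`exists_closedImmersion_range_eq_of_linSubst` +
✓ `blowupModel_of_range_eq_linCone`). [cite: Hartshorne1977, II Ex. 7.12 and II Example 7.1.1] -/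
theorem blowupModel_of_range_eq_of_linSubst_linCone {k : Type} [Field k] {n r m : ℕ} {H : Scheme.{0}}
    (ιH : H ⟶ (projectiveSpace (n + 1) k).left) [IsClosedImmersion ιH] [IsIntegral H] (F : MvPolynomial (Fin (n + 1 + 1)) k)
    (hrange : letI := MvPolynomial.gradedAlgebra (σ := Fin (n + 1 + 1)) (R := k)
      Set.range ιH = {x : Proj (homogeneousSubmodule (Fin (n + 1 + 1)) k) | F ∈ x.asHomogeneousIdeal})
    (τ τ' : Fin (n + 1 + 1) → MvPolynomial (Fin (n + 1 + 1)) k) (hτ : ∀ i, (τ i).IsHomogeneous 1) (hτ' : ∀ i, (τ' i).IsHomogeneous 1)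
    (hinv : ∀ i, aeval τ (τ' i) = X i) (hinv' : ∀ i, aeval τ' (τ i) = X i)
    (ι : Fin (m + 2) → Fin (n + 1 + 1)) (hι : Function.Injective ι) (e : Fin (r + 1) → Fin (n + 1 + 1)) (he : Function.Injective e)
    (hιe : ∀ l, ι l ∉ Set.range e) (heι : ∀ a, a ∉ Set.range e → a ∈ Set.range ι)
    (G : MvPolynomial (Fin (m + 2)) k) {d : ℕ} (hG : G.IsHomogeneous d) (hGp : Prime G)
    (hreg : ∀ i : Fin (m + 2), IsRegularRing (MvPolynomial (Fin (m + 2)) k ⧸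
      Ideal.span {aeval (Function.update (X : Fin (m + 2) → MvPolynomial (Fin (m + 2)) k) i 1) G}))
    (hF : aeval τ' F = rename ι G) :
    ∃ 𝔞 : H.IdealSheafData, 𝔞 ≠ ⊥ ∧ ∀ (Z : Scheme.{0}) (π : Z ⟶ H), IsBlowup π 𝔞 → Scheme.IsRegular Z := by
  letI := MvPolynomial.gradedAlgebra (σ := Fin (n + 1 + 1)) (R := k)
  obtain ⟨ι₁, hι₁, hrange₁⟩ := exists_closedImmersion_range_eq_of_linSubst τ τ' hτ hτ' hinv hinv' ιH F hrange
  haveI := hι₁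
  rw [hF] at hrange₁
  exact blowupModel_of_range_eq_linCone ι₁ ι hι e he hιe heι G hG hGp hreg hrange₁

end Summit.ResolutionOfSingularities.ResolutionOfSingularities.Cruxes.EquisingularLift.StrataSplit

end
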